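import Summits.ResolutionOfSingularities.ResolutionOfSingularities.Theses.UniformComplexity
import Summits.ResolutionOfSingularities.ResolutionOfSingularities.Theorems.UniformComplexityPrimeModelTransferFamilyResolutionSpread
import Summits.ResolutionOfSingularities.ResolutionOfSingularities.Theorems.UniformComplexityPrimeModelTransferOfFamilyResolution
import Summits.ResolutionOfSingularities.ResolutionOfSingularities.Theorems.UniformComplexityPrimeModelTransferSpecialization
import Summits.ResolutionOfSingularities.ResolutionOfSingularities.Theorems.UniformComplexityCampaignW82SpecializationNormalForms
import Mathlib.FieldTheory.IsAlgClosed.AlgebraicClosure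
import Mathlib.RingTheory.Flat.Basic
import HarnessLib

/-!
# [OURS · L1 W8.2 door 2] THE CRUX `PrimeModelTransfer` IS RESOLUTION IN FAMILIES OVER `𝔽̄_p` —
# by-name links (Theses-importing leaf)

Route `ResolutionOfSingularities/UniformComplexity`, crux `PrimeModelTransfer`
(stmt-ResolutionOfSingularities-8933). The route thesis reads the crux as a UNIFORMITY statement
(«prime-model sufficiency; informally equivalent, via ACF_p-completeness and compactness, to a uniform
bound on resolution complexity over F_p-bar»). The OURS module
`Theorems/UniformComplexityCampaignW82FamilyResolution.lean` (p526769) types that uniformity without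
model theory as `CampaignW82.FamilyResolution k` (simultaneous weak resolution of the field-valued
fibres of every proper family over a finitely generated `k`-domain, after a finite-type algebraic
injective base extension); the two halves are
`Theorems/UniformComplexityPrimeModelTransferOfFamilyResolution.lean` (p528212, «⇐»: family resolution
over `k` ⇒ resolution over every algebraically closed `K ⊇ k`) and
`Theorems/UniformComplexityPrimeModelTransferFamilyResolutionSpread.lean` («⇒»: spreading a resolution of
the geometric generic fibre). THIS FILE records the equivalences BY NAME:

* `familyResolution_of_algClosedRes` — `AlgClosedRes p → ∀ k [CharP k p], FamilyResolution k`;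
* `algClosedRes_iff_familyResolution` — **`AlgClosedRes p ↔ FamilyResolution (AlgebraicClosure (ZMod p))`**:
  resolution of integral varieties over ALL algebraically closed fields of characteristic `p` is
  EQUIVALENT to resolution in families over the single field `𝔽̄_p`;
* `algClosedRes_iff_forall_familyResolution` — `AlgClosedRes p ↔ ∀ k [CharP k p], FamilyResolution k`;
* `primeModelTransferAt_iff_familyResolution` — **the crux slice:
  `PrimeModelTransferAt p ↔ (PrimeClosureRes p → FamilyResolution (AlgebraicClosure (ZMod p)))`**;
* `primeModelTransferAt_iff_forall_primeModel_familyResolution` — the same with the crux's own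
  hypothesis fields (algebraically closed `k` of characteristic `p` whose elements satisfy
  `x ^ p ^ n = x`): `PrimeModelTransferAt p ↔ ∀` such `k`, resolution over `k` → `FamilyResolution k`;
* `primeModelTransfer_iff_familyResolution` — for the route declaration:
  `Theses.UniformComplexity.PrimeModelTransfer ↔ ∀ (p : ℕ) [Fact p.Prime], PrimeClosureRes p →
  FamilyResolution (AlgebraicClosure (ZMod p))` (`Fact p.Prime` as an instance binder, since
  `AlgebraicClosure (ZMod p)` needs the field structure on `ZMod p`).

Reading for the slot (W8.2 «transfer FAMILIES, not fibres»): door 2's exact residual is the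
statement that 𝔽̄_p-families of varieties admit, generically on the base and after an algebraic base
extension, SIMULTANEOUS resolutions with SMOOTH fibres — a relative/uniform resolution statement over
the prime model; resolving the (regular) total space is not enough (barrier files
`RegularNotGeometricallyRegular.lean`, `FrobeniusTwistResolution.lean`,
`InseparableBaseChangeResolution.lean`), and the census of gens 0–4 (`TwistExponent*`, `TwistNormal*`,
pv-1's `Selection*`) says the smooth model must be CHOSEN (not any resolution) at a base extension
depending on the family.

[OURS · LADDER-RESOLUTION L1, slot W8.2 (prime-field / universality transfer), door 2
UniformComplexity] Theorems over the summit's own route and OURS names; NOT statements of, and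
attributing nothing to, Hironaka's 2017 manuscript (the OURS `Prop`s replace the role of §17 ¶2,
p.89 l.59–62). AI-written; weaker than expert review. Theses-importing LEAF (imports the route file
directly, and otherwise only Theses-free modules); nothing imports this file.
-/

noncomputable section

set_option linter.dupNamespace false -- mandated namespace of this single-conjunct summit

open CategoryTheory CategoryTheory.Limits AlgebraicGeometry TopologicalSpace
open Literature.AlgebraicGeometry.Resolution
open Summit.ResolutionOfSingularities.ResolutionOfSingularities.Theses.UniformComplexity (PrimeModelTransfer)

namespace Summit.ResolutionOfSingularities.ResolutionOfSingularities.Theorems.CampaignW82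

open PrimeModelTransfer in
/-- **THE CRUX ⇒ RESOLUTION IN FAMILIES over every field of characteristic `p`.** If every integral
separated scheme of finite type over every algebraically closed field of characteristic `p` has a
resolution (`AlgClosedRes p`), then `FamilyResolution k` holds for EVERY field `k` of characteristic
`p`: for a finitely generated `k`-domain `A`, `L := (Frac A)^{alg}` (`AlgebraicClosure (FractionRing A)`)
is algebraically closed of characteristic `p`, algebraic over `A` with injective structure map, the
geometric generic fibre `X_L` of a proper family is proper over `L`, hence resolvable by
`AlgClosedRes p` when integral, and `PrimeModelTransfer.exists_familyResolution_datum` spreads that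
resolution. [cite: EGAIV3, Thm. 8.10.5] -/
theorem familyResolution_of_algClosedRes (p : ℕ) [Fact p.Prime] (hres : AlgClosedRes p)
    (k : Type) [Field k] [CharP k p] : FamilyResolution k := by
  intro A _ _ _ hAft 𝒳 f hf hint
  haveI := hAft
  haveI := hf
  haveI : IsNoetherianRing A := Algebra.FiniteType.isNoetherianRing k A
  haveI : CharP A p := charP_of_injective_algebraMap (algebraMap k A).injective p
  haveI : Algebra.IsAlgebraic A (FractionRing A) :=
    IsLocalization.isAlgebraic (FractionRing A) (nonZeroDivisors A)
  haveI : Algebra.IsAlgebraic A (AlgebraicClosure (FractionRing A)) :=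
    Algebra.IsAlgebraic.trans A (FractionRing A) (AlgebraicClosure (FractionRing A))
  have hAL : Function.Injective (algebraMap A (AlgebraicClosure (FractionRing A))) := by
    rw [IsScalarTower.algebraMap_eq A (FractionRing A) (AlgebraicClosure (FractionRing A))]
    exact (algebraMap (FractionRing A) (AlgebraicClosure (FractionRing A))).injective.comp
      (IsFractionRing.injective A (FractionRing A))
  haveI : CharP (AlgebraicClosure (FractionRing A)) p := charP_of_injective_algebraMap hAL p
  haveI : PerfectField (AlgebraicClosure (FractionRing A)) :=
    IsAlgClosed.perfectField (AlgebraicClosure (FractionRing A))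
  haveI := hint
  have hY : Scheme.HasResolution (pullback f (Spec.map (CommRingCat.ofHom
      (algebraMap A (AlgebraicClosure (FractionRing A)))))) :=
    hres (AlgebraicClosure (FractionRing A)) _ (pullback.snd f _) inferInstance inferInstance
      inferInstance hint
  exact exists_familyResolution_datum A (AlgebraicClosure (FractionRing A)) hAL 𝒳 f hint hY

/-- **Resolution over all algebraically closed fields of characteristic `p` ⟺ resolution in
families over `𝔽̄_p`.** `AlgClosedRes p ↔ FamilyResolution (AlgebraicClosure (ZMod p))`
(→ `familyResolution_of_algClosedRes`; ← `PrimeModelTransfer.algClosedRes_of_familyResolution`,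
p528212, `𝔽̄_p` being algebraic over `ZMod p`). [folklore] -/
theorem algClosedRes_iff_familyResolution (p : ℕ) [Fact p.Prime] :
    AlgClosedRes p ↔ FamilyResolution (AlgebraicClosure (ZMod p)) := by
  haveI : CharP (AlgebraicClosure (ZMod p)) p :=
    charP_of_injective_algebraMap (algebraMap (ZMod p) (AlgebraicClosure (ZMod p))).injective p
  exact ⟨fun h => familyResolution_of_algClosedRes p h _,
    fun h => PrimeModelTransfer.algClosedRes_of_familyResolution p (AlgebraicClosure (ZMod p)) h⟩

/-- `AlgClosedRes p ↔` resolution in families over EVERY field of characteristic `p`. [folklore] -/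
theorem algClosedRes_iff_forall_familyResolution (p : ℕ) [Fact p.Prime] :
    AlgClosedRes p ↔ ∀ (k : Type) [Field k] [CharP k p], FamilyResolution k := by
  refine ⟨fun h k _ _ => familyResolution_of_algClosedRes p h k, fun h => ?_⟩
  haveI : CharP (AlgebraicClosure (ZMod p)) p :=
    charP_of_injective_algebraMap (algebraMap (ZMod p) (AlgebraicClosure (ZMod p))).injective p
  exact (algClosedRes_iff_familyResolution p).mpr (h _)

/-- **THE CRUX SLICE IS RESOLUTION IN FAMILIES OVER THE PRIME MODEL, BY NAME.** For a prime `p`: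
`PrimeModelTransferAt p ↔ (PrimeClosureRes p → FamilyResolution (AlgebraicClosure (ZMod p)))` —
«resolution over `𝔽̄_p` implies resolution over every algebraically closed field of characteristic
`p`» holds if and only if «resolution over `𝔽̄_p` implies RESOLUTION IN FAMILIES over `𝔽̄_p`»
(`PrimeModelTransferAt p` is `PrimeClosureRes p → AlgClosedRes p` by definition, p481773).
[folklore] -/
theorem primeModelTransferAt_iff_familyResolution (p : ℕ) [Fact p.Prime] :
    PrimeModelTransferAt p ↔ (PrimeClosureRes p → FamilyResolution (AlgebraicClosure (ZMod p))) :=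
  imp_congr_right fun _ => algClosedRes_iff_familyResolution p

/-- The crux slice with the crux's OWN hypothesis fields: `PrimeModelTransferAt p` holds iff for
every algebraically closed `k` of characteristic `p` whose elements satisfy `x ^ p ^ n = x` for some
`n ≥ 1` (`k ≅ 𝔽̄_p`), resolution of the integral separated finite-type `k`-schemes implies
`FamilyResolution k` (← `PrimeModelTransfer.primeModelTransferAt_of_familyResolution`, p528212;
→ resolution over one such `k` gives `PrimeClosureRes p` by specialization along
`IsAlgClosed.lift : k' → k`, `PrimeModelTransfer.integralResOver_of_integralResOver_extension`
p484634, then `familyResolution_of_algClosedRes`). [folklore] -/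
theorem primeModelTransferAt_iff_forall_primeModel_familyResolution {p : ℕ} (hp : p.Prime) :
    PrimeModelTransferAt p ↔
      ∀ (k : Type) [Field k] [CharP k p] [IsAlgClosed k], (∀ x : k, ∃ n : ℕ, 0 < n ∧ x ^ p ^ n = x) →
        (∀ (X : Scheme.{0}) (f : X ⟶ Spec (.of k)), IsSeparated f → LocallyOfFiniteType f →
            QuasiCompact f → IsIntegral X → Scheme.HasResolution X) →
        FamilyResolution k := by
  haveI : Fact p.Prime := ⟨hp⟩
  refine ⟨fun h k _ _ _ _ hRes => ?_, PrimeModelTransfer.primeModelTransferAt_of_familyResolution hp⟩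
  -- resolution over ONE algebraically closed `k` of characteristic `p` gives `PrimeClosureRes p`
  have hPC : PrimeClosureRes p := by
    intro k' _ _ _ hk' X f hs hl hq hX
    letI : Algebra (ZMod p) k' := ZMod.algebra k' p
    letI : Algebra (ZMod p) k := ZMod.algebra k p
    haveI : Algebra.IsAlgebraic (ZMod p) k' := by
      refine ⟨fun x => ?_⟩
      obtain ⟨n, hn, hx⟩ := hk' x
      have hdeg : 1 < p ^ n := Nat.one_lt_pow hn.ne' hp.one_lt
      refine ⟨Polynomial.X ^ (p ^ n) - Polynomial.X, ?_, by simp [hx]⟩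
      intro h0
      have := congrArg Polynomial.natDegree h0
      rw [Polynomial.natDegree_sub_eq_left_of_natDegree_lt (by simpa using hdeg),
        Polynomial.natDegree_X_pow, Polynomial.natDegree_zero] at this
      exact (Nat.pos_of_ne_zero (by omega) |>.ne') this |>.elim
    let ι : k' →ₐ[ZMod p] k := IsAlgClosed.lift
    letI : Algebra k' k := ι.toRingHom.toAlgebra
    haveI : PerfectField k := IsAlgClosed.perfectField k
    exact PrimeModelTransfer.integralResOver_of_integralResOver_extension k' k hRes X f hs hl hq hX
  exact familyResolution_of_algClosedRes p (h hPC) k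

/-- **For the route declaration.** `Theses.UniformComplexity.PrimeModelTransfer` holds iff for every
prime `p`, resolution over the algebraically closed fields algebraic over `𝔽_p` implies RESOLUTION IN
FAMILIES over `𝔽̄_p = AlgebraicClosure (ZMod p)` (the route declaration is `∀ p, p.Prime → PrimeModelTransferAt p`
definitionally — `primeModelTransfer_iff_forall_primeModelTransferAt`, p488474, is `Iff.rfl` — and
`primeModelTransferAt_iff_familyResolution`). [folklore] -/
theorem primeModelTransfer_iff_familyResolution :
    PrimeModelTransfer ↔ ∀ (p : ℕ) [Fact p.Prime],
      PrimeClosureRes p → FamilyResolution (AlgebraicClosure (ZMod p)) := by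
  change (∀ p : ℕ, p.Prime → PrimeModelTransferAt p) ↔ _
  constructor
  · intro h p hp
    exact (primeModelTransferAt_iff_familyResolution p).mp (h p hp.out)
  · intro h p hp
    haveI : Fact p.Prime := ⟨hp⟩
    exact (primeModelTransferAt_iff_familyResolution p).mpr (h p)


/-! ## v2 (APPEND-ONLY, res-L1-s82-pv-2 gen 5): resolution in families does not depend on the ground field -/

/-- **RESOLUTION IN FAMILIES OVER ANY ONE FIELD OF CHARACTERISTIC `p` ⟺ RESOLUTION OVER ALL
ALGEBRAICALLY CLOSED FIELDS OF CHARACTERISTIC `p`.** For a prime `p` and EVERY field `k` of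
characteristic `p` (not only the prime model): `FamilyResolution k ↔ AlgClosedRes p`. In particular
`FamilyResolution k` does not depend on `k` within a characteristic (`familyResolution_iff_of_charP`).
«←» is `familyResolution_of_algClosedRes`. «→»: given an algebraically closed `K'` of characteristic
`p`, let `K` be an algebraic closure of a residue field of `k ⊗_{𝔽_p} K'` (a non-zero ring:
`Algebra.TensorProduct.includeLeft_injective`, `k` being flat over the field `ZMod p`) — an
algebraically closed field receiving both `k` and `K'`; `FamilyResolution k` gives resolution over
`K ⊇ k` (`PrimeModelTransfer.hasResolution_of_familyResolution`, p528212), and resolution descends from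
`K` to the algebraically closed subfield `K'` by SPECIALIZATION
(`PrimeModelTransfer.integralResOver_of_integralResOver_extension`, p484634). [folklore] -/
theorem familyResolution_iff_algClosedRes (p : ℕ) [Fact p.Prime] (k : Type) [Field k] [CharP k p] :
    FamilyResolution k ↔ AlgClosedRes p := by
  refine ⟨fun hFR => ?_, fun h => familyResolution_of_algClosedRes p h k⟩
  intro K' _ _ _ X f hs hl hq hX
  -- a common algebraically closed extension `K` of `k` and `K'`
  letI : Algebra (ZMod p) k := ZMod.algebra k p
  letI : Algebra (ZMod p) K' := ZMod.algebra K' p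
  haveI : Nontrivial (TensorProduct (ZMod p) k K') :=
    (Algebra.TensorProduct.includeLeft_injective (R := ZMod p) (S := ZMod p) (A := k) (B := K')
      (algebraMap (ZMod p) K').injective).nontrivial
  obtain ⟨𝔪, h𝔪⟩ := Ideal.exists_maximal (TensorProduct (ZMod p) k K')
  let K₀ : Type := TensorProduct (ZMod p) k K' ⧸ 𝔪
  letI : Field K₀ := Ideal.Quotient.field 𝔪
  let K : Type := AlgebraicClosure K₀
  let ιk : k →+* K := (algebraMap K₀ K).comp ((Ideal.Quotient.mk 𝔪).comp
    (Algebra.TensorProduct.includeLeft (R := ZMod p) (S := ZMod p) (A := k) (B := K')).toRingHom)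
  let ιK' : K' →+* K := (algebraMap K₀ K).comp ((Ideal.Quotient.mk 𝔪).comp
    (Algebra.TensorProduct.includeRight (R := ZMod p) (A := k) (B := K')).toRingHom)
  letI : Algebra k K := ιk.toAlgebra
  letI : Algebra K' K := ιK'.toAlgebra
  haveI : PerfectField K := IsAlgClosed.perfectField K
  have hResK : ∀ (Y : Scheme.{0}) (g : Y ⟶ Spec (.of K)), IsSeparated g → LocallyOfFiniteType g →
      QuasiCompact g → IsIntegral Y → Scheme.HasResolution Y := by
    intro Y g hs' hl' hq' hY'
    haveI := hs'; haveI := hl'; haveI := hq'; haveI := hY'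
    exact PrimeModelTransfer.hasResolution_of_familyResolution k K hFR Y g
  exact PrimeModelTransfer.integralResOver_of_integralResOver_extension K' K hResK X f hs hl hq hX

/-- `FamilyResolution k ↔ FamilyResolution k'` for any two fields of the same positive characteristic
(both sides are `AlgClosedRes p`). [folklore] -/
theorem familyResolution_iff_of_charP (p : ℕ) [Fact p.Prime] (k k' : Type) [Field k] [CharP k p]
    [Field k'] [CharP k' p] : FamilyResolution k ↔ FamilyResolution k' :=
  (familyResolution_iff_algClosedRes p k).trans (familyResolution_iff_algClosedRes p k').symm

/-- The crux slice with ANY field of characteristic `p` as the family base: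
`PrimeModelTransferAt p ↔ (PrimeClosureRes p → FamilyResolution k)`. [folklore] -/
theorem primeModelTransferAt_iff_familyResolution_of_charP (p : ℕ) [Fact p.Prime] (k : Type) [Field k]
    [CharP k p] : PrimeModelTransferAt p ↔ (PrimeClosureRes p → FamilyResolution k) :=
  imp_congr_right fun _ => (familyResolution_iff_algClosedRes p k).symm

end Summit.ResolutionOfSingularities.ResolutionOfSingularities.Theorems.CampaignW82

end
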